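import Summits.CriticalPhenomena.PercolationContinuityZ3.Theorems.PercNearOneGluingNoHeavyLowerTailStarSetPoolBound
import Summits.CriticalPhenomena.PercolationContinuityZ3.Theorems.PercNearOneGluingNoHeavyLowerTailStarSetPoolGroup
import HarnessLib

/-!
# `NoHeavyLowerTail` (stmt-CriticalPhenomena-4575) — the scaled pool inequality (P∅) of U1-PROOF.md §7 (L7.2 + L7.3(i) + L7.3(ii))

Support file (prover `prim-gen-swap` gen 15; `--supports stmt-CriticalPhenomena-4575`).  No definitions, no named facts, no sorries.

The POOL of the U1′_r charging scheme pays the core configurations of the residual `𝓤_dom` pairs `(X, J)` (U1-PROOF.md §7,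
LEAN-BLUEPRINT-U1.md §F6/§G4).  After target scaling the inequality to prove is `(P∅)`: the total NEED — demand minus `P ×` the pool
words, floored at `0` — of all pairs is at most `1` (in units of the pool credit `E₀ = 1/P`).  The pairs come in partner groups:
the groups `J ≠ I₀` (hubs `𝒳_J`, triangle matching `M_J`, need bounded by L7.2 `pool_group_need_le`), the cold hubs of the `I₀`-group
(L7.3(i), `pool_cold_need_le`) and the I-hot bundles (L7.3(ii), `pool_hot_need_posPart_le_half`); `pool_cold_total_le_half` adds up
the first two to `1/2`.  This file only combines those landed inequalities:

* `StarSet.pool_groups_need_le` — `Σ_J t_J · NEED_J ≤ (P − 1 − T)/(2(P−1))` when `Σ_J t_J ≤ P − 1 − T`;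
* `StarSet.pool_scaled_total_le_one` — (P∅): cold + hot + groups `≤ 1`.
-/

namespace Summit.CriticalPhenomena.PercolationContinuityZ3.Theorems

open Finset
open scoped BigOperators

namespace StarSet

variable {ι κ γ : Type*}

/-- **The partner groups `J ≠ I₀` together (L7.2 summed):** if every group's need is at most `t_J/(2(P−1))` in shape
(`pool_group_need_le`) and `Σ_J t_J ≤ P − 1 − T`, the total is at most `(P−1−T)/(2(P−1))`. -/
theorem pool_groups_need_le [DecidableEq ι] (Js : Finset κ) (𝒳 : κ → Finset ι) (tJ : κ → ℝ) (htJ0 : ∀ J ∈ Js, 0 ≤ tJ J)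
    (t : κ → ι → ℝ) (ht0 : ∀ J ∈ Js, ∀ X ∈ 𝒳 J, 0 ≤ t J X)
    (M : κ → ι → ι → Prop) [∀ J, DecidableRel (M J)] (hMsymm : ∀ J ∈ Js, ∀ X ∈ 𝒳 J, ∀ Y ∈ 𝒳 J, M J X Y → M J Y X)
    (hMuniq : ∀ J ∈ Js, ∀ X ∈ 𝒳 J, ({Y ∈ 𝒳 J | Y ≠ X ∧ M J X Y} : Finset ι).card ≤ 1)
    (P T : ℝ) (hP : 1 < P) (hsum : ∑ J ∈ Js, tJ J ≤ P - 1 - T) :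
    ∑ J ∈ Js, tJ J * ∑ X ∈ 𝒳 J, t J X * max 0 (1 - (P - 1) * (t J X + ∑ Y ∈ 𝒳 J with (Y ≠ X ∧ ¬ M J X Y), t J Y)) ≤
      (P - 1 - T) / (2 * (P - 1)) := by
  have hc : 0 < P - 1 := by linarith
  have hgroup : ∀ J ∈ Js, ∑ X ∈ 𝒳 J, t J X * max 0 (1 - (P - 1) * (t J X + ∑ Y ∈ 𝒳 J with (Y ≠ X ∧ ¬ M J X Y), t J Y)) ≤
      1 / (2 * (P - 1)) :=
    fun J hJ => pool_group_need_le (𝒳 J) (t J) (ht0 J hJ) (M J) (hMsymm J hJ) (hMuniq J hJ) (P - 1) hc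
  calc ∑ J ∈ Js, tJ J * ∑ X ∈ 𝒳 J, t J X * max 0 (1 - (P - 1) * (t J X + ∑ Y ∈ 𝒳 J with (Y ≠ X ∧ ¬ M J X Y), t J Y))
      ≤ ∑ J ∈ Js, tJ J * (1 / (2 * (P - 1))) :=
        sum_le_sum fun J hJ => mul_le_mul_of_nonneg_left (hgroup J hJ) (htJ0 J hJ)
    _ = (∑ J ∈ Js, tJ J) * (1 / (2 * (P - 1))) := by rw [sum_mul]
    _ ≤ (P - 1 - T) * (1 / (2 * (P - 1))) := mul_le_mul_of_nonneg_right hsum (by positivity)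
    _ = (P - 1 - T) / (2 * (P - 1)) := by ring

/-- **(P∅) — the scaled pool inequality of U1-PROOF.md §7:** cold I₀-hubs (demand `T t_X`, self word `P T t_X²`, half cross words
`½ P T t_X t_Y`), I-hot bundles (demand `t_X (T + d + T d)`, self word `P T t_X d`, half cross words) and the partner groups `J ≠ I₀`
(demand `t_X t_J`, words `(P−1) t_X t_J (t_X + Σ_{unmatched} t_Y)`) have total floored need at most `1`, provided
`P ≥ 1 + T + Σ_J t_J`, `P ≥ (1+T) Π_{hot}(1+t_X) Π_{dominators}(1+d)`, hot hubs have `t_X ≤ min(T, d_{D X})` and every dominator carries at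
most two hot hubs; `s'` is any common upper bound for the hub weights of the `I₀`-group entering the cross words. -/
theorem pool_scaled_total_le_one [DecidableEq ι] [DecidableEq γ]
    -- the I₀-group: cold hubs `Hc`, hot hubs `Hh` with dominators `D : ι → γ` in `G`
    (Hc Hh : Finset ι) (G : Finset γ) (D : ι → γ) (hD : ∀ X ∈ Hh, D X ∈ G)
    (x : ι → ℝ) (d : γ → ℝ) (T P s' : ℝ) (hT : 0 ≤ T)
    (hx0c : ∀ X ∈ Hc, 0 ≤ x X) (hx0h : ∀ X ∈ Hh, 0 ≤ x X) (hxT : ∀ X ∈ Hh, x X ≤ T) (hxd : ∀ X ∈ Hh, x X ≤ d (D X))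
    (hd0 : ∀ δ ∈ G, 0 ≤ d δ) (hfib : ∀ δ ∈ G, ({X ∈ Hh | D X = δ} : Finset ι).card ≤ 2)
    (hPhot : (1 + T) * ((∏ X ∈ Hh, (1 + x X)) * ∏ δ ∈ G, (1 + d δ)) ≤ P)
    (hs'c : ∑ X ∈ Hc, x X ≤ s') (hs'h : ∑ X ∈ Hh, x X ≤ s')
    -- the partner groups `J ≠ I₀`
    (Js : Finset κ) (𝒳 : κ → Finset ι) (tJ : κ → ℝ) (htJ0 : ∀ J ∈ Js, 0 ≤ tJ J)
    (t : κ → ι → ℝ) (ht0 : ∀ J ∈ Js, ∀ X ∈ 𝒳 J, 0 ≤ t J X)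
    (M : κ → ι → ι → Prop) [∀ J, DecidableRel (M J)] (hMsymm : ∀ J ∈ Js, ∀ X ∈ 𝒳 J, ∀ Y ∈ 𝒳 J, M J X Y → M J Y X)
    (hMuniq : ∀ J ∈ Js, ∀ X ∈ 𝒳 J, ({Y ∈ 𝒳 J | Y ≠ X ∧ M J X Y} : Finset ι).card ≤ 1)
    (hPsum : 1 + T + ∑ J ∈ Js, tJ J ≤ P) :
    T * ∑ X ∈ Hc, x X * max 0 (1 - P * x X - P * (s' - x X) / 2) +
      ∑ X ∈ Hh, x X * max 0 (T + d (D X) + T * d (D X) - P * T * d (D X) - P * T * (s' - x X) / 2) +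
      ∑ J ∈ Js, tJ J * ∑ X ∈ 𝒳 J, t J X * max 0 (1 - (P - 1) * (t J X + ∑ Y ∈ 𝒳 J with (Y ≠ X ∧ ¬ M J X Y), t J Y)) ≤ 1 := by
  have hsumJ0 : 0 ≤ ∑ J ∈ Js, tJ J := sum_nonneg htJ0
  have hP1 : 1 ≤ P := by linarith
  -- the hot bundles: at most `1/2` (L7.3(ii))
  have hhot : ∑ X ∈ Hh, x X * max 0 (T + d (D X) + T * d (D X) - P * T * d (D X) - P * T * (s' - x X) / 2) ≤ 1 / 2 :=
    pool_hot_need_posPart_le_half Hh G D hD x d T P s' hT hx0h hxT hxd hd0 hfib hPhot hs'h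
  by_cases hPeq : P = 1
  · -- degenerate case: `T = 0` and all `t_J = 0`
    have hT0 : T = 0 := by linarith
    have htJ : ∀ J ∈ Js, tJ J = 0 := by
      intro J hJ
      have hle : ∑ J ∈ Js, tJ J ≤ 0 := by linarith
      have hge : tJ J ≤ ∑ J ∈ Js, tJ J := single_le_sum htJ0 hJ
      linarith [htJ0 J hJ]
    have hcold0 : T * ∑ X ∈ Hc, x X * max 0 (1 - P * x X - P * (s' - x X) / 2) = 0 := by rw [hT0, zero_mul]
    have hgroups0 : ∑ J ∈ Js, tJ J * ∑ X ∈ 𝒳 J, t J X *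
        max 0 (1 - (P - 1) * (t J X + ∑ Y ∈ 𝒳 J with (Y ≠ X ∧ ¬ M J X Y), t J Y)) = 0 :=
      sum_eq_zero fun J hJ => by rw [htJ J hJ, zero_mul]
    rw [hcold0, hgroups0]
    linarith
  have hP : 1 < P := lt_of_le_of_ne hP1 (Ne.symm hPeq)
  have hP0 : 0 < P := by linarith
  -- the cold hubs: at most `T/(2P)` (L7.3(i))
  have hcold : T * ∑ X ∈ Hc, x X * max 0 (1 - P * x X - P * (s' - x X) / 2) ≤ T * (1 / (2 * P)) :=
    mul_le_mul_of_nonneg_left (pool_cold_need_le Hc x hx0c P s' hP0 hs'c) hT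
  -- the groups: at most `(P−1−T)/(2(P−1))` (L7.2)
  have hgroups := pool_groups_need_le Js 𝒳 tJ htJ0 t ht0 M hMsymm hMuniq P T hP (by linarith)
  -- total (L7.3(i) arithmetic)
  have htot := pool_cold_total_le_half P T hP hT
  have hTP : T * (1 / (2 * P)) = T / (2 * P) := by ring
  linarith

end StarSet

end Summit.CriticalPhenomena.PercolationContinuityZ3.Theorems
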